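import Literature.MathematicalPhysics.QuantumLattice.WilsonDiracAP
import Literature.MathematicalPhysics.QuantumFieldTheory.FlatLatticeGaugeFields
import Summits.QuantumFields.QCD.Theorems.QuarksAsStableActionCriticalLineDiamagnetismStubCellGainOfGauged

/-!
# Flat cell optimum: fold identity and link-oddness of reflection tilings (helper for crux stmt-QuantumFields-9307)

Group-generic structural facts about the period-2 reflection tiling `tile c V` of the closed unit
cell at `c` (the `let tile` of `Summit.QuantumFields.QCD.Theses.WilsonQuarkChessboard.FlatCellOptimal`
and of both stubs of its line `Cruxes/FlatCellOptimal/Lines/birth.lean`), on EVEN tori `(ℤ/L)⁴` and for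
ANY link group `G` (so for `U(N)`, every `N`).  `tile` enters through its DEFINING EQUATION (`htile`),
so the skeleton's reducible abbreviation is matched by `fun _ _ _ => rfl`.

* `gaugeTransform_tile`, `tile_gaugeTransform` — the FOLD IDENTITY `tile_c (V^g) = (tile_c V)^{g ∘ fold_c}`:
  the tiling of a gauge copy is a gauge copy of the tiling.
* `tile_mul_tile_shift` — reflection tilings are LINK-REFLECTION ODD: `W(x, μ) · W(x + μ̂, μ) = 1`;
  hence straight paths of even length have trivial holonomy (`lineHolonomy_two_mul_eq_one`).
* `exists_eq_gaugeTransform_one` — FLAT + LINK-ODD ⇒ PURE GAUGE: by the tree's toron theorem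
  `exists_gaugeTransform_seamConfig_of_flat` a flat field is a gauge copy of a commuting seam
  configuration; its seam values are read off full straight cycles (`lineHolonomy_seamConfig_cycle`,
  `lineHolonomy_gaugeTransform`), which are trivial for link-odd fields on even tori.
* `eq_one_of_re_trace_eq`, `deficit_eq_zero_iff` — `N − Re tr u = 0` iff `u = 1` on `U(N)`, so
  "all plaquette deficits vanish" is flatness.

References: G. 't Hooft, Nucl. Phys. B 153 (1979) 141; M. Lüscher, Nucl. Phys. B 219 (1983) 233 §2
(flat lattice connections on the torus = torons); M. Creutz, *Quarks, gluons and lattices* (1983) Ch. 9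
(axial gauge).  Pure theorem file (no definitions); the `ZMod`-parity and fold lemmas at fixed offset
parity are REUSED from the sibling line (`…CriticalLineDiamagnetismStubCellGainOfGauged`, namespace
`…ChessboardCellGain.CellGainOfGauged`: `zmod_val_add_one_mod_two`, `fold_shift_of_even`,
`shift_fold_shift_of_odd`), whose `N = 3` link group plays no role in them.
-/

noncomputable section

open scoped BigOperators Classical Matrix ComplexConjugate
open Literature.MathematicalPhysics.QuantumLattice Literature.MathematicalPhysics.QuantumFieldTheory

namespace Summit.QuantumFields.QCD.Cruxes.FlatCellOptimal.GaugeOrbit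

open Summit.QuantumFields.QCD.Cruxes.CriticalLineDiamagnetism.ChessboardCellGain.CellGainOfGauged
  (zmod_val_add_one_mod_two fold_shift_of_even shift_fold_shift_of_odd)

variable {N L : ℕ}

/-! ### `ZMod` and shift bookkeeping -/

/-- `(x + μ̂)_μ = x_μ + 1`. -/
theorem shift_apply_self {d : ℕ} (x : Site d L) (μ : Fin d) : Site.shift x μ μ = x μ + 1 := by
  simp [Literature.MathematicalPhysics.QuantumFieldTheory.Site.shift]

/-- `(x + μ̂)_ν = x_ν` for `ν ≠ μ`. -/
theorem shift_apply_of_ne {d : ℕ} (x : Site d L) {μ ν : Fin d} (h : ν ≠ μ) :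
    Site.shift x μ ν = x ν := by
  simp [Literature.MathematicalPhysics.QuantumFieldTheory.Site.shift, Pi.single_eq_of_ne h]

/-! ### Unitary matrices: `Re tr u = N` only for `u = 1` -/

/-- For `u ∈ U(N)`: `Re tr u = N` forces `u = 1` (unit rows). -/
theorem eq_one_of_re_trace_eq {U : Matrix (Fin N) (Fin N) ℂ}
    (hU : U ∈ Matrix.unitaryGroup (Fin N) ℂ) (htr : U.trace.re = N) : U = 1 := by
  -- adapted from `eq_one_of_re_trace_eq` of Literature/Barriers/QuantumFields/DiscreteSubgroupFreezing.lean
  have hW := Matrix.mem_unitaryGroup_iff.1 hU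
  have hrow2 : ∀ i, ∑ j, ‖U i j‖ ^ 2 = 1 := by
    intro i
    have h1 : ∑ j, U i j * star (U i j) = 1 := by
      have := congrFun (congrFun hW i) i
      simpa [Matrix.mul_apply, Matrix.star_apply, Matrix.one_apply] using this
    have : ∀ j, U i j * star (U i j) = ((‖U i j‖ ^ 2 : ℝ) : ℂ) := by
      intro j
      rw [Complex.star_def, Complex.mul_conj, Complex.normSq_eq_norm_sq]
    simp_rw [this] at h1
    exact_mod_cast h1
  have hdiag_le : ∀ i, ‖U i i‖ ≤ 1 := by
    intro i
    have h3 : ‖U i i‖ ^ 2 ≤ 1 := by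
      rw [← hrow2 i]
      exact Finset.single_le_sum (f := fun j => ‖U i j‖ ^ 2) (fun j _ => by positivity)
        (Finset.mem_univ i)
    nlinarith [norm_nonneg (U i i)]
  have hre : ∀ i, (U i i).re = 1 := by
    have hsum : ∑ i, (U i i).re = N := by
      have : U.trace.re = ∑ i, (U i i).re := by rw [Matrix.trace]; simp [Complex.re_sum]
      rw [← this, htr]
    have hle : ∀ i ∈ (Finset.univ : Finset (Fin N)), (U i i).re ≤ 1 :=
      fun i _ => (Complex.re_le_norm _).trans (hdiag_le i)
    by_contra hcon
    push Not at hcon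
    obtain ⟨i, hi⟩ := hcon
    have hlt : (U i i).re < 1 := lt_of_le_of_ne (hle i (Finset.mem_univ i)) hi
    have : ∑ i, (U i i).re < ∑ _i : Fin N, (1 : ℝ) :=
      Finset.sum_lt_sum hle ⟨i, Finset.mem_univ i, hlt⟩
    simp at this
    linarith
  have hdiag : ∀ i, U i i = 1 := by
    intro i
    have h1 : ‖U i i‖ = 1 := le_antisymm (hdiag_le i) (by
      have := Complex.re_le_norm (U i i); rw [hre i] at this; exact this)
    have him : (U i i).im = 0 := by
      have hsq : (U i i).re ^ 2 + (U i i).im ^ 2 = ‖U i i‖ ^ 2 := by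
        rw [← Complex.normSq_eq_norm_sq, Complex.normSq_apply]; ring
      rw [hre i, h1] at hsq
      nlinarith
    exact Complex.ext (by simp [hre i]) (by simp [him])
  have hoff : ∀ i j, j ≠ i → U i j = 0 := by
    intro i j hji
    have h := hrow2 i
    rw [← Finset.add_sum_erase _ _ (Finset.mem_univ i), hdiag i, norm_one, one_pow] at h
    have hzero : ∑ x ∈ Finset.univ.erase i, ‖U i x‖ ^ 2 = 0 := by linarith
    have := (Finset.sum_eq_zero_iff_of_nonneg (fun x _ => by positivity)).1 hzero j
      (Finset.mem_erase.2 ⟨hji, Finset.mem_univ j⟩)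
    simpa using this
  ext i j
  by_cases h : i = j
  · subst h; rw [hdiag i, Matrix.one_apply_eq]
  · rw [hoff i j (Ne.symm h), Matrix.one_apply_ne h]

/-- The plaquette deficit `N − Re tr u` of `u ∈ U(N)` vanishes exactly at `u = 1`. -/
theorem deficit_eq_zero_iff (u : Matrix.unitaryGroup (Fin N) ℂ) :
    (N : ℝ) - ((unitaryFundamentalRep (Fin N) ℂ) u).trace.re = 0 ↔ u = 1 := by
  rw [unitaryFundamentalRep_apply, sub_eq_zero]
  constructor
  · intro h
    exact Subtype.ext (eq_one_of_re_trace_eq u.2 h.symm)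
  · rintro rfl
    simp [Matrix.trace_one]

/-! ### The fold identity: the tiling of a gauge copy is a gauge copy of the tiling (even `L`) -/

section Fold

variable {G : Type*} [Group G]

/-- Two shifts do not change the fold (even `L`). -/
theorem fold_shift_shift [NeZero L] (hL : Even L) (c x : Site 4 L) (μ : Fin 4) :
    (fun ν => c ν + (((Site.shift (Site.shift x μ) μ ν - c ν).val % 2 : ℕ) : ZMod L)) =
      fun ν => c ν + (((x ν - c ν).val % 2 : ℕ) : ZMod L) := by
  funext ν
  by_cases hν : ν = μ
  · subst hν
    have h1 : (x ν - c ν + 1 + 1).val % 2 = ((x ν - c ν + 1).val + 1) % 2 :=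
      zmod_val_add_one_mod_two hL _
    have h2 : (x ν - c ν + 1).val % 2 = ((x ν - c ν).val + 1) % 2 := zmod_val_add_one_mod_two hL _
    have h3 : (x ν - c ν + 1 + 1).val % 2 = (x ν - c ν).val % 2 := by omega
    rw [shift_apply_self, shift_apply_self,
      show x ν + 1 + 1 - c ν = x ν - c ν + 1 + 1 by abel, h3]
  · rw [shift_apply_of_ne _ hν, shift_apply_of_ne x hν]

/-- **The fold identity**, explicit form: `(tile_c V)^{g ∘ fold_c} = tile_c (V^g)` (even `L`). -/
theorem gaugeTransform_tile [NeZero L] (hL : Even L) (g : Site 4 L → G) (V : GaugeConfig 4 L G)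
    (c : Site 4 L) :
    gaugeTransform (fun x => g (fun ν => c ν + (((x ν - c ν).val % 2 : ℕ) : ZMod L)))
        (fun e => if (e.1 e.2 - c e.2).val % 2 = 0
          then V (fun ν => c ν + (((e.1 ν - c ν).val % 2 : ℕ) : ZMod L), e.2)
          else (V (fun ν => c ν + (((Site.shift e.1 e.2 ν - c ν).val % 2 : ℕ) : ZMod L), e.2))⁻¹) =
      fun e : Edge 4 L => if (e.1 e.2 - c e.2).val % 2 = 0
          then gaugeTransform g V (fun ν => c ν + (((e.1 ν - c ν).val % 2 : ℕ) : ZMod L), e.2)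
          else (gaugeTransform g V
            (fun ν => c ν + (((Site.shift e.1 e.2 ν - c ν).val % 2 : ℕ) : ZMod L), e.2))⁻¹ := by
  -- adapted from `CellGainOfGauged.gaugeTransform_tile` (…StubCellGainOfGauged.lean), any group
  funext e
  simp only [gaugeTransform]
  split_ifs with h
  · rw [fold_shift_of_even hL c e.1 e.2 h]
  · rw [_root_.mul_inv_rev, _root_.mul_inv_rev, inv_inv, shift_fold_shift_of_odd hL c e.1 e.2 h,
      mul_assoc]

/-- **The fold identity** for any `tile` satisfying the items' defining equation:
`tile_c (V^g) = (tile_c V)^{g ∘ fold_c}` (even `L`, any group). -/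
theorem tile_gaugeTransform [NeZero L] (hL : Even L)
    {tile : Site 4 L → GaugeConfig 4 L G → GaugeConfig 4 L G}
    (htile : ∀ (c : Site 4 L) (V : GaugeConfig 4 L G) (e : Edge 4 L),
      tile c V e = if (e.1 e.2 - c e.2).val % 2 = 0
        then V (fun ν => c ν + (((e.1 ν - c ν).val % 2 : ℕ) : ZMod L), e.2)
        else (V (fun ν => c ν + (((Site.shift e.1 e.2 ν - c ν).val % 2 : ℕ) : ZMod L), e.2))⁻¹)
    (g : Site 4 L → G) (V : GaugeConfig 4 L G) (c : Site 4 L) :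
    tile c (gaugeTransform g V) =
      gaugeTransform (fun x => g (fun ν => c ν + (((x ν - c ν).val % 2 : ℕ) : ZMod L))) (tile c V) := by
  have hV : tile c V = fun e : Edge 4 L => if (e.1 e.2 - c e.2).val % 2 = 0
      then V (fun ν => c ν + (((e.1 ν - c ν).val % 2 : ℕ) : ZMod L), e.2)
      else (V (fun ν => c ν + (((Site.shift e.1 e.2 ν - c ν).val % 2 : ℕ) : ZMod L), e.2))⁻¹ :=
    funext (htile c V)
  rw [hV, gaugeTransform_tile hL g V c]
  exact funext (htile c (gaugeTransform g V))

/-- **Reflection tilings are link-reflection odd**: `W(x, μ) · W(x + μ̂, μ) = 1` for `W = tile_c V`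
(even `L`, any group) — consecutive links in direction `μ` read `V_e, V_e⁻¹` or `V_e⁻¹, V_e`. -/
theorem tile_mul_tile_shift [NeZero L] (hL : Even L)
    {tile : Site 4 L → GaugeConfig 4 L G → GaugeConfig 4 L G}
    (htile : ∀ (c : Site 4 L) (V : GaugeConfig 4 L G) (e : Edge 4 L),
      tile c V e = if (e.1 e.2 - c e.2).val % 2 = 0
        then V (fun ν => c ν + (((e.1 ν - c ν).val % 2 : ℕ) : ZMod L), e.2)
        else (V (fun ν => c ν + (((Site.shift e.1 e.2 ν - c ν).val % 2 : ℕ) : ZMod L), e.2))⁻¹)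
    (V : GaugeConfig 4 L G) (c x : Site 4 L) (μ : Fin 4) :
    tile c V (x, μ) * tile c V (Site.shift x μ, μ) = 1 := by
  have hpar : (Site.shift x μ μ - c μ).val % 2 = ((x μ - c μ).val + 1) % 2 := by
    rw [shift_apply_self, add_sub_right_comm, zmod_val_add_one_mod_two hL]
  have hx : tile c V (x, μ) = if (x μ - c μ).val % 2 = 0
      then V (fun ν => c ν + (((x ν - c ν).val % 2 : ℕ) : ZMod L), μ)
      else (V (fun ν => c ν + (((Site.shift x μ ν - c ν).val % 2 : ℕ) : ZMod L), μ))⁻¹ :=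
    htile c V (x, μ)
  have hx' : tile c V (Site.shift x μ, μ) = if (Site.shift x μ μ - c μ).val % 2 = 0
      then V (fun ν => c ν + (((Site.shift x μ ν - c ν).val % 2 : ℕ) : ZMod L), μ)
      else (V (fun ν => c ν +
        (((Site.shift (Site.shift x μ) μ ν - c ν).val % 2 : ℕ) : ZMod L), μ))⁻¹ :=
    htile c V (Site.shift x μ, μ)
  by_cases h : (x μ - c μ).val % 2 = 0
  · have h' : ¬ (Site.shift x μ μ - c μ).val % 2 = 0 := by rw [hpar]; omega
    rw [hx, hx', if_pos h, if_neg h', fold_shift_shift hL c x μ, mul_inv_cancel]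
  · have h' : (Site.shift x μ μ - c μ).val % 2 = 0 := by rw [hpar]; omega
    rw [hx, hx', if_neg h, if_pos h', inv_mul_cancel]

/-- The tiling of the trivial field is trivial. -/
theorem tile_one {tile : Site 4 L → GaugeConfig 4 L G → GaugeConfig 4 L G}
    (htile : ∀ (c : Site 4 L) (V : GaugeConfig 4 L G) (e : Edge 4 L),
      tile c V e = if (e.1 e.2 - c e.2).val % 2 = 0
        then V (fun ν => c ν + (((e.1 ν - c ν).val % 2 : ℕ) : ZMod L), e.2)
        else (V (fun ν => c ν + (((Site.shift e.1 e.2 ν - c ν).val % 2 : ℕ) : ZMod L), e.2))⁻¹)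
    (c : Site 4 L) : tile c (1 : GaugeConfig 4 L G) = 1 := by
  funext e
  rw [htile]
  split_ifs <;> simp

/-! ### Straight cycles: holonomies of link-odd fields, gauge covariance, seam configurations -/

/-- A link-reflection odd field has trivial holonomy along every straight path of even length. -/
theorem lineHolonomy_two_mul_eq_one {d : ℕ} {W : GaugeConfig d L G} (μ : Fin d)
    (hW : ∀ x : Site d L, W (x, μ) * W (Site.shift x μ, μ) = 1) :
    ∀ (n : ℕ) (y : Site d L), lineHolonomy W μ (2 * n) y = 1
  | 0, y => by simp [lineHolonomy]
  | n + 1, y => by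
    rw [show 2 * (n + 1) = (2 * n + 1) + 1 by ring, lineHolonomy, lineHolonomy, ← mul_assoc, hW,
      one_mul]
    exact lineHolonomy_two_mul_eq_one μ hW n _

/-- Straight transports transform at their end points. -/
theorem lineHolonomy_gaugeTransform {d : ℕ} (g : Site d L → G) (U : GaugeConfig d L G) (k : Fin d) :
    ∀ (n : ℕ) (x : Site d L), lineHolonomy (gaugeTransform g U) k n x =
      g x * lineHolonomy U k n x * (g (x + Pi.single k (n : ZMod L)))⁻¹
  -- adapted from `lineHolonomy_gaugeTransform` of
  -- Summits/QuantumFields/QCD/Theorems/RobustYangMillsRG/Negative/WildBlocking.lean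
  | 0, x => by simp [lineHolonomy]
  | n + 1, x => by
    rw [lineHolonomy, lineHolonomy, lineHolonomy_gaugeTransform g U k n (x.shift k),
      WilsonLoopRP.shift_add_single]
    simp only [gaugeTransform, Literature.MathematicalPhysics.QuantumFieldTheory.Site.shift]
    group

/-- A seam configuration is trivial along straight paths that do not reach the seam. -/
theorem lineHolonomy_seamConfig_of_lt {d : ℕ} [NeZero L] (h : Fin d → G) (k : Fin d) :
    ∀ (n : ℕ) (y : Site d L), (y k).val + n + 1 ≤ L → lineHolonomy (seamConfig L h) k n y = 1
  | 0, y, _ => by simp [lineHolonomy]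
  | n + 1, y, hy => by
    have hne : (y k).val + 1 ≠ L := by omega
    have hL1 : L ≠ 1 := by omega
    have h1 : (1 : ZMod L).val = 1 := ZMod.val_one'' hL1
    have hval : (Site.shift y k k).val = (y k).val + 1 := by
      rw [shift_apply_self, ZMod.val_add_of_lt (by rw [h1]; omega), h1]
    have hy0 : seamConfig L h (y, k) = 1 := by
      simp [seamConfig, hne]
    rw [lineHolonomy, hy0, one_mul]
    exact lineHolonomy_seamConfig_of_lt h k n _ (by rw [hval]; omega)

/-- Around a full straight cycle (based at the origin) a seam configuration reads its seam value. -/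
theorem lineHolonomy_seamConfig_cycle {d : ℕ} [NeZero L] (h : Fin d → G) (k : Fin d) :
    lineHolonomy (seamConfig L h) k L (0 : Site d L) = h k := by
  have hL : 1 ≤ L := NeZero.one_le
  have h1 : lineHolonomy (seamConfig L h) k L (0 : Site d L) =
      lineHolonomy (seamConfig L h) k (L - 1 + 1) 0 := by
    rw [Nat.sub_add_cancel hL]
  have h0 : ((0 : Site d L) k).val + (L - 1) + 1 ≤ L := by
    simp only [Pi.zero_apply, ZMod.val_zero]
    omega
  rw [h1, WilsonLoopRP.lineHolonomy_succ_right, lineHolonomy_seamConfig_of_lt h k (L - 1) 0 h0, one_mul,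
    zero_add]
  simp only [seamConfig]
  rw [Pi.single_eq_same, ZMod.val_natCast, Nat.mod_eq_of_lt (by omega), Nat.sub_add_cancel hL, if_pos rfl]

/-- The seam configuration of the trivial tuple is the trivial field. -/
theorem seamConfig_one {d : ℕ} : seamConfig L (fun _ : Fin d => (1 : G)) = 1 := by
  funext e
  simp [seamConfig]

/-- **Flat + link-odd ⇒ pure gauge.** A flat field on an even torus all of whose straight
`2`-step transports are trivial is a gauge transform of the trivial field (its toron `h` is `1`). -/
theorem exists_eq_gaugeTransform_one [NeZero L] (hL : Even L) {W : GaugeConfig 4 L G}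
    (hflat : ∀ (x : Site 4 L) (i j : Fin 4), plaquetteHolonomy W x i j = 1)
    (hodd : ∀ (x : Site 4 L) (μ : Fin 4), W (x, μ) * W (Site.shift x μ, μ) = 1) :
    ∃ g : Site 4 L → G, W = gaugeTransform g 1 := by
  obtain ⟨g, h, -, hW⟩ := exists_gaugeTransform_seamConfig_of_flat hflat
  have hh : h = fun _ => 1 := by
    funext μ
    obtain ⟨n, hn⟩ := hL
    have hcyc : lineHolonomy W μ L 0 = 1 := by
      have := lineHolonomy_two_mul_eq_one μ (fun x => hodd x μ) n 0
      rwa [two_mul, ← hn] at this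
    rw [hW, lineHolonomy_gaugeTransform, lineHolonomy_seamConfig_cycle, ZMod.natCast_self,
      Pi.single_zero, add_zero, mul_inv_eq_one] at hcyc
    exact mul_left_cancel (hcyc.trans (mul_one _).symm)
  refine ⟨g, ?_⟩
  rw [hW, hh, seamConfig_one]

end Fold

/-- **Registered sub-goal of this helper file** (`stub_tilePureGaugeOfFlat`, crux stmt-QuantumFields-9307):
for every `N` and even `L`, a reflection tiling `tile c U` all of whose plaquette deficits vanish is a gauge
transform of the trivial `U(N)` field (spelled in the crux's own `let tile`). -/
theorem stub_tilePureGaugeOfFlat : ∀ (N L : ℕ) [NeZero L], Even L → ∀ (U : Literature.MathematicalPhysics.QuantumFieldTheory.GaugeConfig 4 L (Matrix.unitaryGroup (Fin N) ℂ)) (c : Literature.MathematicalPhysics.QuantumFieldTheory.Site 4 L), let tile : Literature.MathematicalPhysics.QuantumFieldTheory.Site 4 L → Literature.MathematicalPhysics.QuantumFieldTheory.GaugeConfig 4 L (Matrix.unitaryGroup (Fin N) ℂ) → Literature.MathematicalPhysics.QuantumFieldTheory.GaugeConfig 4 L (Matrix.unitaryGroup (Fin N) ℂ) := fun c V e =>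 if (e.1 e.2 - c e.2).val % 2 = 0 then V (fun ν => c ν + (((e.1 ν - c ν).val % 2 : ℕ) : ZMod L), e.2) else (V (fun ν => c ν + (((Literature.MathematicalPhysics.QuantumFieldTheory.Site.shift e.1 e.2 ν - c ν).val % 2 : ℕ) : ZMod L), e.2))⁻¹; (∀ (x : Literature.MathematicalPhysics.QuantumFieldTheory.Site 4 L) (i j : Fin 4), (N : ℝ) - ((Literature.MathematicalPhysics.QuantumLattice.unitaryFundamentalRep (Fin N) ℂ) (Literature.MathematicalPhysics.QuantumFieldTheory.plaquetteHolonomy (tile c U) x i j)).trace.re = 0) → ∃ g : Literature.MathematicalPhysics.QuantumFieldTheory.Site 4 L → Matrix.unitaryGroup (Fin N) ℂ, tile c U = Literature.MathematicalPhysics.QuantumFieldTheory.gaugeTransform g 1 := by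
  intro N L _ hL U c tile hflat
  exact exists_eq_gaugeTransform_one hL (fun x i j => (deficit_eq_zero_iff _).1 (hflat x i j))
    (fun x μ => tile_mul_tile_shift hL (tile := tile) (fun _ _ _ => rfl) U c x μ)

end Summit.QuantumFields.QCD.Cruxes.FlatCellOptimal.GaugeOrbit

end
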